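import Literature.NumberTheory.Rogawski1990.ArchBouazizStableFamilyModel           -- ★ p850992 (this seat): the model package (`exists_placeLeaves_stOrbFamH_model`), Fubini for given leaves
import Literature.NumberTheory.Rogawski1990.ArchBouazizWallLinePrelims             -- ★ p851010 (this seat): `integral_pi_subtype_eq_single`, normal line, `one_sub_circleExp_eq_two_sin_mul`, Dirac product
import Literature.NumberTheory.Rogawski1990.ArchEndoscopicAmbientPlaceUpdate        -- ★ p850963 (this seat): (α4-S2) `exists_clm_ambient_endoEmbArch_update` (ambient matrix affine in the place block)
import Literature.NumberTheory.Automorphic.ArchRankOneOrbitalVolumeWallBound         -- ★ p850846 (this seat): `coe_conj_eq_smul_of_coe_eq_smul`, `coe_cayleyTorus_eq_smul`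
import HarnessLib

/-!
# THE WALL-PLACE REPRESENTATION OF THE MODEL, STEP 1: the inner integral at a compact place `w₀` as a whole-group orbital integral of an UPDATED family, its ambient reading
# `Θ(ι + Λ(u · ↑↑(h · P t_1(ψ) P⁻¹ · h⁻¹)))`, and the restriction of the outer integral to the compact where the integrand lives (stage (α4-S4a) of `ALPHA4-DESIGN.v1.md`)

Topic `NumberTheory/Rogawski1990`; namespace `Literature.NumberTheory.Rogawski1990`.  THEOREMS ONLY (no `def`, no instance, no axiom, no `sorry`).  Cell `pub/hodgecm-mathlib`,
crux H413 (`stmt-HodgeConjecture-24833`), line LH3 (closer stub `stub_N9`, DIRECT ROAD), organ O-L3′ conjunct (ii) pay-down for GENERAL `fH` (LH3-plan (g3) RULINGS #7 (d) ∕ #11).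
Author LH3-p01 (g4).  Count-neutral.

WHAT.  Three rewriting steps between the Fubini clause of ★ `exists_placeLeaves_stOrbFamH_model` (with `p := (· = w₀)`) and the averaged functional of ★ (α4-S3)
`exists_forall_eventually_norm_iteratedDeriv_average_orbitalIntegral_cayley_le`:
* §1 **`integral_pi_eq_single_update`** — the inner integral over `Π_{w : {w // w = w₀}} G_w` of `fH(eA⁻¹(w ↦ [w = w₀ ? g_w γ g_w⁻¹ : m_w]), b)` IS `∫_{G_{w₀}} fH(eA⁻¹(update M w₀ (h γ h⁻¹)), b) dν_{w₀}(h)`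
  with `M = (w ↦ [w = w₀ ? 1 : m_w])` (★ `integral_pi_subtype_eq_single`; the dependent `if` is the `update` of `M`);
* §2 **`apply_symm_update_conj_eq_ambient`** — for `fH = Θ ∘ ↑↑ι_∞` (★ `ArchSmooth₂.exists_contDiff`), `Λ` the place-update map of ★ (α4-S2) and `M w₀ = 1`:
  `fH(eA⁻¹(update M w₀ (h γ_{w₀}(c) h⁻¹)), b) = Θ((↑↑ι_∞(eA⁻¹ M, b) − Λ 1) + Λ(u · ↑↑(h · P t_1(ψ) P⁻¹ · h⁻¹)))` with the Cayley-centre reading `γ_{w₀}(c) = P t_u(ψ) P⁻¹` of ★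
  `endoBlock_eq_cayleyTorus_of_not_mem` (`t_u = u · t_1`, ★ `coe_conj_eq_smul_of_coe_eq_smul`) — the `Φ(ι p, Y) = Θ(ι₁ p + Λ(u_p · Y))` shape of ★ (α4-S3);
* §3 **`integral_eq_integral_subtype_of_support`** — an integral against a measure carried by `Z` of a function vanishing on `Z ∖ 𝔖` is the integral over the subtype `𝔖` against
  `comap val` (the compact parameter space and finite measure of ★ (α4-S3)); **`comap_subtype_real_univ_le`**.
HONEST LABEL: HC_CM is proved only modulo the 7 printed citations (2 remaining: hLiu418 = stmt-HodgeConjecture-24832, h413 = stmt-HodgeConjecture-24833) until rung 0 closes;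
rewriting steps, pay nothing by themselves.

## References
* [Varadarajan1989] V. S. Varadarajan, *An Introduction to Harmonic Analysis on Semisimple Lie Groups*, Cambridge Stud. Adv. Math. 16 (1989), §6.4 Lemma 21, Thms 22–23.
* [Bouaziz1994IntegralesOrbitales] A. Bouaziz, *Intégrales orbitales sur les algèbres de Lie réductives*, Invent. Math. 115 (1994), §3.1 p. 579.
* [Rogawski1990] J. D. Rogawski, *Automorphic Representations of Unitary Groups in Three Variables*, Ann. of Math. Stud. 123 (1990), §4.8 p. 53; §8.2 pp. 119–122.
* [Folland1995] G. B. Folland, *A Course in Abstract Harmonic Analysis* (1995), §2.6 (2.52).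
-/

set_option autoImplicit false

noncomputable section

open MeasureTheory Measure Filter Topology Set Function NumberField NumberField.InfinitePlace NumberField.mixedEmbedding Matrix Complex
open Literature.NumberTheory.Automorphic Literature.NumberTheory.Automorphic.UnitaryGroup Literature.NumberTheory.Automorphic.ArchCartan
open scoped ContDiff Classical MatrixGroups Matrix ENNReal NNReal

namespace Literature.NumberTheory.Rogawski1990

local notation3 "Φ₂[" L "]" => (Matrix.of fun i j : Fin 2 => if i.val + j.val + 1 = 2 then (1 : L) else 0)
local notation3 "Φ₁[" L "]" => (Matrix.of fun i j : Fin 1 => if i.val + j.val + 1 = 1 then (1 : L) else 0)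
local notation3 "𝔸[" L "]" => ↥(arch (↥(maximalRealSubfield L)) L (IsCMField.complexConj L) 2 Φ₂[L])
local notation3 "𝔹[" L "]" => ↥(arch (↥(maximalRealSubfield L)) L (IsCMField.complexConj L) 1 Φ₁[L])

/-! ## §1 The inner integral at `w₀` is a whole-group orbital integral of the updated family -/

section Inner

variable (L : Type) [Field L] [NumberField L] [IsCMField L] (S : Finset {w : InfinitePlace L // IsComplex w}) (w₀ : {w : InfinitePlace L // IsComplex w})
  [∀ w : {w : InfinitePlace L // IsComplex w}, MeasurableSpace ↥(archLocal L 2 Φ₂[L] w)]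

omit [NumberField L] [IsCMField L] in
/-- **THE INNER INTEGRAL AT `w₀` AS AN UPDATE**: for families `M, γ : Π_w G_w` and any `F`,
`∫_{Π_{w : {w // w = w₀}} G_w} F(w ↦ [h : w = w₀ ? g⟨w,h⟩ γ_w (g⟨w,h⟩)⁻¹ : M w]) d(⊗ ν) = ∫_{G_{w₀}} F(update M w₀ (h γ_{w₀} h⁻¹)) dν_{w₀}(h)` — the dependent `if` IS the update, and the
product over the one-point index type is the factor (★ `integral_pi_subtype_eq_single`). [cite: Folland1995, §2.6 (2.52)] [cite: Varadarajan1989, §6.4 Lemma 21] -/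
theorem integral_pi_eq_single_update {E : Type*} [NormedAddCommGroup E] [NormedSpace ℝ E] [Fintype {w : {w : InfinitePlace L // IsComplex w} // w = w₀}]
    (νw : ∀ w : {w : InfinitePlace L // IsComplex w}, Measure ↥(archLocal L 2 Φ₂[L] w)) [∀ w, SigmaFinite (νw w)]
    (M γ : ∀ w : {w : InfinitePlace L // IsComplex w}, ↥(archLocal L 2 Φ₂[L] w)) (F : (∀ w : {w : InfinitePlace L // IsComplex w}, ↥(archLocal L 2 Φ₂[L] w)) → E) :
    (∫ g : ∀ w : {w : {w : InfinitePlace L // IsComplex w} // w = w₀}, ↥(archLocal L 2 Φ₂[L] w.1),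
        F (fun w => if h : w = w₀ then g ⟨w, h⟩ * γ w * (g ⟨w, h⟩)⁻¹ else M w)
        ∂(Measure.pi fun w : {w : {w : InfinitePlace L // IsComplex w} // w = w₀} => νw w.1)) =
      ∫ hh : ↥(archLocal L 2 Φ₂[L] w₀), F (Function.update M w₀ (hh * γ w₀ * hh⁻¹)) ∂(νw w₀) := by
  have hpt : ∀ g : ∀ w : {w : {w : InfinitePlace L // IsComplex w} // w = w₀}, ↥(archLocal L 2 Φ₂[L] w.1),
      (fun w => if h : w = w₀ then g ⟨w, h⟩ * γ w * (g ⟨w, h⟩)⁻¹ else M w) = Function.update M w₀ (g ⟨w₀, rfl⟩ * γ w₀ * (g ⟨w₀, rfl⟩)⁻¹) := by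
    intro g
    funext w
    by_cases h : w = w₀
    · subst h
      rw [dif_pos rfl, Function.update_self]
    · rw [dif_neg h, Function.update_of_ne h]
  simp only [hpt]
  exact integral_pi_subtype_eq_single w₀ (fun w => νw w) fun hh => F (Function.update M w₀ (hh * γ w₀ * hh⁻¹))

end Inner

/-! ## §2 The ambient reading of the updated integrand: `Θ(ι + Λ(u · ↑↑(h · P t_1(ψ) P⁻¹ · h⁻¹)))` -/

section Ambient

variable (L : Type) [Field L] [NumberField L] [IsCMField L] (S : Finset {w : InfinitePlace L // IsComplex w}) (w₀ : {w : InfinitePlace L // IsComplex w})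

/-- **THE AMBIENT READING AT THE WALL PLACE**: for `fH = Θ ∘ ↑↑ι_∞`, `Λ` with the place-update identity of ★ (α4-S2) at `w₀ ∉ S`, a family `M` with `M w₀ = 1`, and every integer `m`:
`fH(eA⁻¹(update M w₀ (h γ_{w₀}(c) h⁻¹)), b) = Θ((↑↑ι_∞(eA⁻¹ M, b) − Λ 1) + Λ(u · ↑↑(h · P t_1(ψ) P⁻¹ · h⁻¹)))`, `ψ = (c_{w₀}0 − c_{w₀}2)/2 − mπ`, `u = e^{i((c_{w₀}0 + c_{w₀}2)/2 + mπ)}`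
(★ `endoBlock_eq_cayleyTorus_of_not_mem`, ★ `coe_conj_eq_smul_of_coe_eq_smul`). [cite: Rogawski1990, §4.8 p. 53; §8.2 p. 122] [cite: Varadarajan1989, §6.4 Lemma 21] -/
theorem apply_symm_update_conj_eq_ambient (hw₀ : w₀ ∉ S) {fH : 𝔸[L] × 𝔹[L] → ℂ} {Θ : Matrix (Fin 3) (Fin 3) (mixedSpace L) → ℂ}
    (hΘf : ∀ k, fH k = Θ (((endoEmbArch L k).val : GL (Fin 3) (mixedSpace L)) : Matrix (Fin 3) (Fin 3) (mixedSpace L)))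
    (Λ : Matrix (Fin 2) (Fin 2) ℂ →L[ℝ] Matrix (Fin 3) (Fin 3) (mixedSpace L))
    (hΛ : ∀ (G : ∀ w : {w : InfinitePlace L // IsComplex w}, ↥(archLocal L 2 Φ₂[L] w)) (Y : ↥(archLocal L 2 Φ₂[L] w₀)) (b : 𝔹[L]),
      (((endoEmbArch L ((archPiEquivCM 2 L Φ₂[L]).symm (Function.update G w₀ Y), b)).val : GL (Fin 3) (mixedSpace L)) : Matrix (Fin 3) (Fin 3) (mixedSpace L)) =
        (((endoEmbArch L ((archPiEquivCM 2 L Φ₂[L]).symm G, b)).val : GL (Fin 3) (mixedSpace L)) : Matrix (Fin 3) (Fin 3) (mixedSpace L)) +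
          Λ ((((Y : ↥(archLocal L 2 Φ₂[L] w₀)) : GL (Fin 2) ℂ) : Matrix (Fin 2) (Fin 2) ℂ) - (((G w₀ : ↥(archLocal L 2 Φ₂[L] w₀)) : GL (Fin 2) ℂ) : Matrix (Fin 2) (Fin 2) ℂ)))
    (M : ∀ w : {w : InfinitePlace L // IsComplex w}, ↥(archLocal L 2 Φ₂[L] w)) (hM : M w₀ = 1) (b : 𝔹[L])
    (c : {w : InfinitePlace L // IsComplex w} → Fin 3 → ℝ) (m : ℤ) (hh : ↥(archLocal L 2 Φ₂[L] w₀)) :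
    fH ((archPiEquivCM 2 L Φ₂[L]).symm (Function.update M w₀ (hh * endoBlockAt L S w₀ (c w₀) * hh⁻¹)), b) =
      Θ (((((endoEmbArch L ((archPiEquivCM 2 L Φ₂[L]).symm M, b)).val : GL (Fin 3) (mixedSpace L)) : Matrix (Fin 3) (Fin 3) (mixedSpace L)) - Λ 1) +
        Λ (((Circle.exp ((c w₀ 0 + c w₀ 2) / 2 + m * Real.pi) : Circle) : ℂ) •
          (((hh * ⟨Matrix.GeneralLinearGroup.mkOfDetNeZero !![(1 : ℂ), 1; 1, -1] det_cayleyTwo_ne_zero *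
              circleDiagonal 2 ![1 * Circle.exp ((c w₀ 0 - c w₀ 2) / 2 - m * Real.pi), 1 * Circle.exp (-((c w₀ 0 - c w₀ 2) / 2 - m * Real.pi))] *
              (Matrix.GeneralLinearGroup.mkOfDetNeZero !![(1 : ℂ), 1; 1, -1] det_cayleyTwo_ne_zero)⁻¹, cayley_conj_circleDiagonal_mem_archLocal L w₀ _⟩ * hh⁻¹ :
            ↥(archLocal L 2 Φ₂[L] w₀)) : GL (Fin 2) ℂ) : Matrix (Fin 2) (Fin 2) ℂ))) := by
  rw [hΘf, hΛ M _ b, hM, map_sub]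
  -- the conjugate of the Cayley torus point scales with the centre
  have hγ : endoBlockAt L S w₀ (c w₀) = ⟨Matrix.GeneralLinearGroup.mkOfDetNeZero !![(1 : ℂ), 1; 1, -1] det_cayleyTwo_ne_zero *
      circleDiagonal 2 ![Circle.exp ((c w₀ 0 + c w₀ 2) / 2 + m * Real.pi) * Circle.exp ((c w₀ 0 - c w₀ 2) / 2 - m * Real.pi),
        Circle.exp ((c w₀ 0 + c w₀ 2) / 2 + m * Real.pi) * Circle.exp (-((c w₀ 0 - c w₀ 2) / 2 - m * Real.pi))] *
      (Matrix.GeneralLinearGroup.mkOfDetNeZero !![(1 : ℂ), 1; 1, -1] det_cayleyTwo_ne_zero)⁻¹, cayley_conj_circleDiagonal_mem_archLocal L w₀ _⟩ :=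
    endoBlock_eq_cayleyTorus_of_not_mem L S w₀ hw₀ c m
  have hconj : (((hh * endoBlockAt L S w₀ (c w₀) * hh⁻¹ : ↥(archLocal L 2 Φ₂[L] w₀)) : GL (Fin 2) ℂ) : Matrix (Fin 2) (Fin 2) ℂ) =
      ((Circle.exp ((c w₀ 0 + c w₀ 2) / 2 + m * Real.pi) : Circle) : ℂ) •
        (((hh * ⟨Matrix.GeneralLinearGroup.mkOfDetNeZero !![(1 : ℂ), 1; 1, -1] det_cayleyTwo_ne_zero *
            circleDiagonal 2 ![1 * Circle.exp ((c w₀ 0 - c w₀ 2) / 2 - m * Real.pi), 1 * Circle.exp (-((c w₀ 0 - c w₀ 2) / 2 - m * Real.pi))] *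
            (Matrix.GeneralLinearGroup.mkOfDetNeZero !![(1 : ℂ), 1; 1, -1] det_cayleyTwo_ne_zero)⁻¹, cayley_conj_circleDiagonal_mem_archLocal L w₀ _⟩ * hh⁻¹ :
          ↥(archLocal L 2 Φ₂[L] w₀)) : GL (Fin 2) ℂ) : Matrix (Fin 2) (Fin 2) ℂ) := by
    rw [hγ]
    exact coe_conj_eq_smul_of_coe_eq_smul (coe_cayleyTorus_eq_smul (Circle.exp ((c w₀ 0 + c w₀ 2) / 2 + m * Real.pi)) ((c w₀ 0 - c w₀ 2) / 2 - m * Real.pi))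
  rw [hconj, OneMemClass.coe_one, Units.val_one]
  abel_nf

end Ambient

/-! ## §3 Restriction of an integral to the compact where the integrand lives, as an integral over the subtype -/

section Support

variable {X : Type*} [MeasurableSpace X] {E : Type*} [NormedAddCommGroup E] [NormedSpace ℝ E]

/-- **An integral against a measure carried by `Z` of a function vanishing on `Z ∖ 𝔖` is the integral over the subtype `𝔖` against `comap val`** (Mathlib `integral_subtype_comap`,
`setIntegral_eq_integral_of_ae_compl_eq_zero`). [cite: Folland1995, §2.6 (2.52)] -/
theorem integral_eq_integral_subtype_of_support (μ : Measure X) {Z 𝔖 : Set X} (h𝔖 : MeasurableSet 𝔖) (hZ : μ Zᶜ = 0) {f : X → E} (hf : ∀ x ∈ Z, x ∉ 𝔖 → f x = 0) :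
    ∫ x, f x ∂μ = ∫ x : 𝔖, f x ∂(Measure.comap Subtype.val μ) := by
  rw [integral_subtype_comap h𝔖, setIntegral_eq_integral_of_ae_compl_eq_zero]
  have hZae : ∀ᵐ x ∂μ, x ∈ Z := mem_ae_iff.2 hZ
  filter_upwards [hZae] with x hx hx𝔖 using hf x hx hx𝔖

/-- The total mass of `comap val μ` on the subtype `𝔖` is `μ 𝔖`. [cite: Folland1995, §2.6 (2.52)] -/
theorem comap_subtype_apply_univ (μ : Measure X) {𝔖 : Set X} (h𝔖 : MeasurableSet 𝔖) : (Measure.comap Subtype.val μ : Measure 𝔖) univ = μ 𝔖 := by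
  rw [comap_subtype_coe_apply h𝔖, Set.image_univ, Subtype.range_coe]

end Support

end Literature.NumberTheory.Rogawski1990

end
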